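import Literature.MathematicalPhysics.QuantumFieldTheory.Balaban1983to89.B9SupplySockB9P3ZdUnivWitness
import Mathlib.LinearAlgebra.Basis.VectorSpace
import Mathlib.LinearAlgebra.Projection

/-!
# `Balaban1983to89.B9SupplySockB9P3ZdUnivWitnessSrc` — [Balaban1985RegularSpaces] Thm 8 + (1.146) p. 101, (1.58)–(1.59) p. 86, Prop. 3 p. 87 /
# [Balaban1985BackgroundPropagators] (3.16) p. 393, (3.20)–(3.27) pp. 394–395, (3.40)–(3.47) pp. 397–398, Thm 3.3 p. 399: THE A6 SATISFIABILITY
# WITNESS FOR THE SOURCED `Ω₀ = ℤᵈ` ROAD OF THE J-N06→N05 JUNCTION — the hypothesis set of `B9SupplySockB9P3ZdAt.sockSrc_core_at_univ'`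
# (ALL TEN letters `DictAt`, `Prop6At`, `InvAt`, `CurvAt`, `LandauAt`, `AvgAt`, `HolderAt`, `GopAddAt`, `SrcAt`, `SrcHolderAt` and Theorem 3.3's two
# blocks for `G(U₀)`) IS INHABITED at every member with `Ω 0 = ℤᵈ` whose truncation-0 constraint bonds are all bonds, truncation `m = 0`

statement-level skeleton of published theorems with citation tags; proofs where landed; nothing here is a claim about the
Yang–Mills mass gap

PDF held: `paper:balaban1985-cmp99-background-propagators` ([4]; journal page = PDF page + 388): p. 393 (3.16), p. 395 (3.26)–(3.27), p. 397 (3.40)–(3.41),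
p. 398 (3.42)–(3.47), p. 399 Thm 3.3; `paper:balaban1985-cmp99-regular-spaces-gauge-fixing` (B8; journal page = PDF page + 74): p. 77, p. 86 (1.55)–(1.59),
p. 87 Prop. 3, p. 101 Thm 8 + (1.146).

CITATION HEADER (lean-in-tree rule).  Cell `pub-ymgap` (HUMAN RULING D-0062, Track A), DAG node N06 [B9] → N05 [B8] junction lineage, seat
`pub-ymgap-dag-n06-b` (g11), 2026-08-27; companion of `B9SupplySockB9P3ZdUnivWitness` (the seven-letter witness of the unsourced road).  That file's
HONEST SCOPE (iii) LOCATED why its letters do not inhabit `GopAddAt`: the binder asks TOTAL additivity of `G(U₀)` over ALL bond fields, the unbounded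
ones included, while `DictAt` + (3.47) (and `HolderAt`) force the readings of `G(U₀)J` to be `≤ B₀·|J|₍₋₃₎ = 0` whenever `J` is UNBOUNDED (r05's junk value
of the weighted supremum).  THIS FILE builds the additive extension that meets both: `G(U₀)J := (K(U₀) + a)⁻¹(PJ) + Ψ(J − PJ)`, where `P` is a
ℂ-linear projection of the space of all bond fields onto the bounded ones (a complement exists — `Submodule.exists_isCompl`, Hamel-type, non-constructive)
and `Ψ` RELOCATES a field onto a sparse family of bonds (sites `4(n+1)²·e₀`, direction `e₀`) — so that for an unbounded `J` the field `G(U₀)J`, its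
covariant gradient, its covariant Laplacian AND its Hölder quotient family are all UNBOUNDED, i.e. every reading is the junk `0` the bounds demand.
A NEW file; nothing landed is modified; count-neutral.

WHAT IS DECLARED ∕ PROVED (kernel, 0 sorry).
* §1 `bddSub` (the ℂ-submodule of bounded bond fields), `projB` (= `Submodule.projection` onto it along a chosen complement), `projB_of_bddF`,
  `bddF_projB`, `not_bddF_sub_projB` (an unbounded field has an unbounded complement part).
* §2 THE SPARSE RELOCATION: `cN n = 4(n+1)²` (injective, gaps `> n`, `≡ 0 mod 4`), `sparseSite`, an injection `encB : bonds → ℕ` (`Countable`), `sig b =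
  (sparseSite (encB b), e₀)`, `PsiU W` (the values of `W` moved onto the bonds `sig b`, `0` elsewhere; additive); vanishing criteria `psiU_eq_zero_of_snd`,
  `psiU_eq_zero_of_coord`, `psiU_eq_zero_of_dir0`; `exists_large` (an unbounded field is large at bonds of arbitrarily large code).
* §3 THE EXTENDED LETTERS `opsUx`: `G(U₀)J := ext((K(U₀) + a)⁻¹ restr (PJ)) + Ψ(J − PJ)` for unitary `U₀` (else `0`), `Δ′ := 0`, `DRD* := 0`, `Q*aQ := a·1`;
  `opsUx_Gop_of_bddF` (= `B9SupplySockB9P3ZdUnivWitness.opsU` on bounded sources), ★ `opsUx_Gop_add` (TOTAL additivity).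
* §4 JUNK READINGS OF AN UNBOUNDED SOURCE: `not_bdd_reading0∕1∕3` (the three (3.47)@−3 families of `G(U₀)J` are unbounded: the value `J`-part at a sparse
  bond, the gradient at `s_n − e₁` (`covDerivFwd` of a spike), the Laplacian at `s_n − e₁` (`covLap_spike`)), `holder_msup_eq_zero_of_not_bddF` (the
  Hölder family is unbounded — pair `(s_n − e_κ, s_n − e_κ + v)` for an admissible displacement `v ≠ 0`, `κ = e₁` unless `v = e₁` (then `κ = e₀`), `n`
  beyond the `e₀`-component of `v` so that the sparse gaps exclude coincidences — or identically `0` when every admissible pair is diagonal).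
* §5 THE FRAME `GAUx` (geometry `B9SupplySockB9P3ZdUnivWitness.geoU`, backgrounds `B9SupplySockB9P3ZdBeta.Witness.bgW`, (3.43) entry `η^{1−β}`, (3.47)@−3
  entries = the readings of `opsUx`): `globUx_bounds`, `holder_lineX`, `one_le_of_ineq343X`.
* §6 ★★ `binders_inhabited_univ_zero_src` — at every `i : ZdIdx d L` with `i.Ω 0 = univ` and every bond in `i.Λb 0 0` (`d ≥ 2`, `0 ≤ β < 1`, any length
  with «non-zero admissible displacement ⇒ length ≥ 1»; any nontrivial C⋆-algebra `𝔸₀ : Type`) the FULL hypothesis set of `sockSrc_core_at_univ'` at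
  `(M, i, m) = (1, i, 0)` — the TEN letters + both blocks of Theorem 3.3 for `G(U₀)` — is INHABITED (constants `K₆ = c₆ = a₃ = a₀ = B₀ = CH = 1`, `c₆₉ = c_S
  = c_{Sβ} = 0`, `q = aη²`, `B₀(·) = B′₀(·) = B′₀(·,·) = 1`) — the same letters serve the unsourced road (the five-line socket corollary is the
  companion's `sockB9P3_at_univ_nonvacuous_zero`, not restated).

HONEST SCOPE.  (i) A satisfiability witness of a hypothesis SET — trivial massive regime plus a non-constructive additive extension on the unbounded
fields (which print never meets: its lattices are finite); it proves NOTHING of [4] or [B8]; it certifies that the ten typed letters of the `ℤᵈ` road are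
jointly consistent at truncation 0 and gives n05-d's sourced record road (`SH59src`, `SB9srcH`) an inhabitant to cite.  (ii) Truncations `m ≥ 1` NOT
witnessed ([4] Sect. A + Thm 3.11 + Thm 3.3 = N06's object content), as in the companion.  (iii) The located wrinkle stands as a READING note for the
binder's owner (this lineage): `GopAddAt` is inhabitable as typed, but only by such an extension; additivity on bounded sources is what print and the member
theorem use.  (iv) Count-neutral; N05∕N06 NOT discharged; nothing continuum ∕ ℝ⁴ ∕ OS ∕ mass-gap ∕ Clay.
-/

noncomputable section

open NormedSpace

namespace Literature.MathematicalPhysics.QuantumFieldTheory.Balaban1983to89.B9SupplySockB9P3ZdUnivWitnessSrc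

open B7Prop1Explicit (e U1 e_apply)
open B7Prop2Explicit (unitaryUnits unitaryUnits_le_U1)
open B7Prop4GeneralLevels (linCovIter)
open B7Eq78Linearization (conjR)
open B8Ineq132 (covDerivFwd covDeriv InAk BondTouches)
open B8Eq140Level (SideTouches)
open B8Eq146AExpansion (iEta)
open B8Eq155JBound (Jcur wsup)
open B8ScaledSupNorm (bondNorm msup weight Bdd)
open B8Eq138LandauZd (IsLandau138 QT covDivB covLap)
open B8LeafModelZd (ZdIdx)
open B8LeafModelZd3 (SockB9P3)
open B9Eq340HolderZd (hquot AdmPair trans)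
open B9SupplySockB9P3ZdLetters (OpsZd deltaAOf)
open B9SupplySockB9P3ZdLettersOmega (OnDom)
open B9SupplySockB9P3ZdAt (DictAt Prop6At InvAt CurvAt LandauAt AvgAt HolderAt GopAddAt SrcAt SrcHolderAt sockB9P3_at_univ')
open B9SupplySockB9P3ZdBeta.Witness (massA bgW)
open B9SupplySockB9P3ZdUnivWitness (BondSp BddF restrU restrU_apply restrU_of_not restrU_add norm_restrU_le extdU extdU_add extdU_zero norm_extdU_le
  bddF_extdU extdU_restrU fpU fpU_add fpU_zero norm_fpU_le fpU_unique phiU_restr_of_eq bddF_Jcur opsU opsU_Gop geoU geoU_len geoU_readings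
  sideTouches_univ hquot_le_of_bound hquot_zero_fun covDerivFwd_zero_fun norm_restrU_le_of_bondNorm)

-- `Site` alone could resolve to the torus sites of `Setup.lean`; re-export the `ℤ^d` sites of `B7Prop1Explicit`.
export B7Prop1Explicit (Site)

variable {d : ℕ} {𝔸 : Type*} [CStarAlgebra 𝔸]

/-! ## §1 The bounded bond fields as a ℂ-submodule and a linear projection onto them -/

section Proj

variable (d 𝔸) in
/-- The ℂ-submodule of BOUNDED bond fields (finite `|·|₍₋₃₎` at truncation 0). [cite: Balaban1985RegularSpaces, p.86 (definition after (1.55))] -/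
def bddSub : Submodule ℂ (Site d → Fin d → 𝔸) where
  carrier := {J | BddF J}
  add_mem' := by
    rintro J₁ J₂ ⟨C₁, hC₁⟩ ⟨C₂, hC₂⟩
    exact ⟨C₁ + C₂, fun x μ => (norm_add_le _ _).trans (add_le_add (hC₁ x μ) (hC₂ x μ))⟩
  zero_mem' := ⟨0, fun x μ => by simp⟩
  smul_mem' := by
    rintro c J ⟨C, hC⟩
    refine ⟨‖c‖ * C, fun x μ => ?_⟩
    rw [Pi.smul_apply, Pi.smul_apply, norm_smul]
    exact mul_le_mul_of_nonneg_left (hC x μ) (norm_nonneg _)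

/-- Membership in `bddSub` is boundedness. [cite: Balaban1985RegularSpaces, p.86 (definition after (1.55))] -/
theorem mem_bddSub {J : Site d → Fin d → 𝔸} : J ∈ bddSub d 𝔸 ↔ BddF J := Iff.rfl

variable (d 𝔸) in
/-- A (Hamel-type, non-constructive) linear complement of the bounded fields. [cite: Balaban1985RegularSpaces, p.86 (bookkeeping of the junk convention)] -/
theorem exists_compl : ∃ q : Submodule ℂ (Site d → Fin d → 𝔸), IsCompl (bddSub d 𝔸) q := Submodule.exists_isCompl _

variable (d 𝔸) in
/-- The chosen complement. [cite: Balaban1985RegularSpaces, p.86 (bookkeeping of the junk convention)] -/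
def complSub : Submodule ℂ (Site d → Fin d → 𝔸) := Classical.choose (exists_compl d 𝔸)

variable (d 𝔸) in
/-- The chosen complement IS a complement. [cite: Balaban1985RegularSpaces, p.86 (bookkeeping of the junk convention)] -/
theorem isCompl_complSub : IsCompl (bddSub d 𝔸) (complSub d 𝔸) := Classical.choose_spec (exists_compl d 𝔸)

/-- **`P`**: the ℂ-linear projection of all bond fields onto the bounded ones along the chosen complement. [cite: Balaban1985RegularSpaces, p.86 (bookkeeping of the junk convention)] -/
def projB : (Site d → Fin d → 𝔸) →ₗ[ℂ] (Site d → Fin d → 𝔸) := (bddSub d 𝔸).projection (complSub d 𝔸) (isCompl_complSub d 𝔸)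

/-- `PJ` is bounded. [cite: Balaban1985RegularSpaces, p.86 (bookkeeping of the junk convention)] -/
theorem bddF_projB (J : Site d → Fin d → 𝔸) : BddF (projB J) :=
  mem_bddSub.1 (Submodule.projection_apply_mem (isCompl_complSub d 𝔸) J)

/-- `PJ = J` for a bounded field. [cite: Balaban1985RegularSpaces, p.86 (bookkeeping of the junk convention)] -/
theorem projB_of_bddF {J : Site d → Fin d → 𝔸} (h : BddF J) : projB J = J :=
  Submodule.projection_apply_of_mem_left (isCompl_complSub d 𝔸) (mem_bddSub.2 h)

/-- The complement part `J − PJ` of an UNBOUNDED field is unbounded (`J = (J − PJ) + PJ`). [cite: Balaban1985RegularSpaces, p.86 (bookkeeping of the junk convention)] -/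
theorem not_bddF_sub_projB {J : Site d → Fin d → 𝔸} (h : ¬ BddF J) : ¬ BddF (J - projB J) := by
  intro hb
  apply h
  have h2 := bddF_projB J
  have : J = (J - projB J) + projB J := by abel
  rw [this]
  exact mem_bddSub.1 ((bddSub d 𝔸).add_mem (mem_bddSub.2 hb) (mem_bddSub.2 h2))

end Proj

/-! ## §2 The sparse relocation `Ψ`: values moved onto the bonds `(4(n+1)²·e₀, e₀)` -/

section Sparse

variable (hd : 1 ≤ d)

/-- The direction `e₀` (`d ≥ 1`). [cite: Balaban1985RegularSpaces, p.76 («e_μ»)] -/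
def dir0 : Fin d := ⟨0, hd⟩

/-- The sparse coordinates `c_n = 4(n+1)²`. [cite: Balaban1985RegularSpaces, p.86 (bookkeeping of the junk convention)] -/
def cN (n : ℕ) : ℤ := 4 * ((n : ℤ) + 1) ^ 2

omit hd in
/-- `c` is injective. [cite: Balaban1985RegularSpaces, p.86 (bookkeeping)] -/
theorem cN_injective : Function.Injective (cN) := by
  intro n m h
  unfold cN at h
  have h1 : (((n + 1 : ℕ) : ℤ)) ^ 2 = (((m + 1 : ℕ) : ℤ)) ^ 2 := by push_cast; linarith
  have h2 : (n + 1) ^ 2 = (m + 1) ^ 2 := by exact_mod_cast h1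
  have h3 : n + 1 = m + 1 := Nat.pow_left_injective (by norm_num) h2
  omega

omit hd in
/-- The sparse GAPS: `|c_m − c_n| > n` for `m ≠ n`. [cite: Balaban1985RegularSpaces, p.86 (bookkeeping)] -/
theorem cN_gap {m n : ℕ} (h : m ≠ n) : (n : ℤ) < |cN m - cN n| := by
  rcases lt_or_gt_of_ne h with hlt | hgt
  · have hm : (m : ℤ) + 1 ≤ n := by exact_mod_cast hlt
    have h0 : (0 : ℤ) ≤ (m : ℤ) + 1 := by positivity
    have h1 : ((m : ℤ) + 1) ^ 2 ≤ (n : ℤ) ^ 2 := by nlinarith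
    have h2 : (n : ℤ) < cN n - cN m := by unfold cN; nlinarith
    rw [abs_sub_comm]
    exact lt_of_lt_of_le h2 (le_abs_self _)
  · have hm : (n : ℤ) + 1 ≤ m := by exact_mod_cast hgt
    have h0 : (0 : ℤ) ≤ (n : ℤ) + 2 := by positivity
    have h1 : ((n : ℤ) + 2) ^ 2 ≤ ((m : ℤ) + 1) ^ 2 := by nlinarith
    have h2 : (n : ℤ) < cN m - cN n := by unfold cN; nlinarith
    exact lt_of_lt_of_le h2 (le_abs_self _)

omit hd in
/-- `c_n − 1` is never a `c_m` (`c ≡ 0 mod 4`). [cite: Balaban1985RegularSpaces, p.86 (bookkeeping)] -/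
theorem cN_sub_one_ne (n m : ℕ) : cN n - 1 ≠ cN m := by
  intro h
  unfold cN at h
  omega

/-- The sparse SITES `s_n = c_n·e₀`. [cite: Balaban1985RegularSpaces, p.86 (bookkeeping of the junk convention)] -/
def sparseSite (n : ℕ) : Site d := fun j => if j = dir0 hd then cN n else 0

/-- `s_n` along `e₀`. [cite: Balaban1985RegularSpaces, p.86 (bookkeeping)] -/
theorem sparseSite_dir0 (n : ℕ) : sparseSite hd n (dir0 hd) = cN n := by simp [sparseSite]

/-- `s_n` vanishes off `e₀`. [cite: Balaban1985RegularSpaces, p.86 (bookkeeping)] -/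
theorem sparseSite_ne (n : ℕ) {j : Fin d} (hj : j ≠ dir0 hd) : sparseSite hd n j = 0 := by simp [sparseSite, hj]

/-- `n ↦ s_n` is injective. [cite: Balaban1985RegularSpaces, p.86 (bookkeeping)] -/
theorem sparseSite_injective : Function.Injective (sparseSite (d := d) hd) := by
  intro n m h
  have := congrFun h (dir0 hd)
  rw [sparseSite_dir0, sparseSite_dir0] at this
  exact cN_injective this

omit hd in
variable (d) in
/-- An injective CODE of the bonds of `ℤᵈ` by natural numbers (`Countable`). [cite: Balaban1985RegularSpaces, p.86 (bookkeeping)] -/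
theorem exists_encB : ∃ f : Site d × Fin d → ℕ, Function.Injective f := Countable.exists_injective_nat _

omit hd in
variable (d) in
/-- The chosen injective code of the bonds. [cite: Balaban1985RegularSpaces, p.86 (bookkeeping)] -/
def encB : Site d × Fin d → ℕ := Classical.choose (exists_encB d)

omit hd in
/-- The code is injective. [cite: Balaban1985RegularSpaces, p.86 (bookkeeping)] -/
theorem encB_injective : Function.Injective (encB d) := Classical.choose_spec (exists_encB d)

/-- **`σ`**: the bond `b` is sent to the sparse bond `(s_{code b}, e₀)`. [cite: Balaban1985RegularSpaces, p.86 (bookkeeping of the junk convention)] -/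
def sig (b : Site d × Fin d) : Site d × Fin d := (sparseSite hd (encB d b), dir0 hd)

/-- `σ` is injective. [cite: Balaban1985RegularSpaces, p.86 (bookkeeping)] -/
theorem sig_injective : Function.Injective (sig (d := d) hd) := by
  intro b b' h
  have h1 := congrArg Prod.fst h
  exact encB_injective (sparseSite_injective hd h1)

/-- A bond in the range of `σ` has direction `e₀`, vanishing coordinates off `e₀`, and `e₀`-coordinate some `c_m`. [cite: Balaban1985RegularSpaces, p.86 (bookkeeping)] -/
theorem of_mem_range_sig {x : Site d} {ν : Fin d} (h : ∃ b, sig hd b = (x, ν)) :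
    ν = dir0 hd ∧ (∀ j, j ≠ dir0 hd → x j = 0) ∧ ∃ m, x (dir0 hd) = cN m := by
  obtain ⟨b, hb⟩ := h
  simp only [sig, Prod.mk.injEq] at hb
  obtain ⟨hx, hν⟩ := hb
  refine ⟨hν.symm, fun j hj => ?_, ⟨encB d b, ?_⟩⟩
  · rw [← hx, sparseSite_ne hd _ hj]
  · rw [← hx, sparseSite_dir0]

open Classical in
/-- **`Ψ`**: RELOCATION of a bond field onto the sparse bonds — `(ΨW)(σ b) = W(b)`, `(ΨW) = 0` off the range of `σ`. [cite: Balaban1985RegularSpaces, p.86 (bookkeeping of the junk convention)] -/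
def PsiU (W : Site d → Fin d → 𝔸) : Site d → Fin d → 𝔸 :=
  fun x ν => if h : ∃ b, sig hd b = (x, ν) then W (Classical.choose h).1 (Classical.choose h).2 else 0

/-- `(ΨW)(σ b) = W b`. [cite: Balaban1985RegularSpaces, p.86 (bookkeeping)] -/
theorem psiU_sig (W : Site d → Fin d → 𝔸) (b : Site d × Fin d) :
    PsiU hd W (sparseSite hd (encB d b)) (dir0 hd) = W b.1 b.2 := by
  have h : ∃ b', sig hd b' = (sparseSite hd (encB d b), dir0 hd) := ⟨b, rfl⟩
  have hc : Classical.choose h = b := sig_injective hd (Classical.choose_spec h)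
  unfold PsiU
  rw [dif_pos h, hc]

/-- `ΨW = 0` off the range of `σ`. [cite: Balaban1985RegularSpaces, p.86 (bookkeeping)] -/
theorem psiU_of_not (W : Site d → Fin d → 𝔸) {x : Site d} {ν : Fin d} (h : ¬ ∃ b, sig hd b = (x, ν)) : PsiU hd W x ν = 0 := by
  unfold PsiU
  rw [dif_neg h]

/-- `ΨW = 0` in every direction other than `e₀`. [cite: Balaban1985RegularSpaces, p.86 (bookkeeping)] -/
theorem psiU_eq_zero_of_snd (W : Site d → Fin d → 𝔸) {x : Site d} {ν : Fin d} (hν : ν ≠ dir0 hd) : PsiU hd W x ν = 0 :=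
  psiU_of_not hd W fun h => hν (of_mem_range_sig hd h).1

/-- `ΨW = 0` at a site with a non-zero coordinate off `e₀`. [cite: Balaban1985RegularSpaces, p.86 (bookkeeping)] -/
theorem psiU_eq_zero_of_coord (W : Site d → Fin d → 𝔸) {x : Site d} {ν : Fin d} {j : Fin d} (hj : j ≠ dir0 hd) (hx : x j ≠ 0) :
    PsiU hd W x ν = 0 :=
  psiU_of_not hd W fun h => hx ((of_mem_range_sig hd h).2.1 j hj)

/-- `ΨW = 0` at a site whose `e₀`-coordinate is no `c_m`. [cite: Balaban1985RegularSpaces, p.86 (bookkeeping)] -/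
theorem psiU_eq_zero_of_dir0 (W : Site d → Fin d → 𝔸) {x : Site d} {ν : Fin d} (hx : ∀ m, x (dir0 hd) ≠ cN m) : PsiU hd W x ν = 0 :=
  psiU_of_not hd W fun h => by obtain ⟨m, hm⟩ := (of_mem_range_sig hd h).2.2; exact hx m hm

/-- `Ψ` is additive. [cite: Balaban1985RegularSpaces, p.86 (bookkeeping)] -/
theorem psiU_add (W₁ W₂ : Site d → Fin d → 𝔸) : PsiU hd (W₁ + W₂) = PsiU hd W₁ + PsiU hd W₂ := by
  funext x ν
  by_cases h : ∃ b, sig hd b = (x, ν)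
  · simp only [PsiU, dif_pos h, Pi.add_apply]
  · simp only [PsiU, dif_neg h, Pi.add_apply, add_zero]

/-- `Ψ0 = 0`. [cite: Balaban1985RegularSpaces, p.86 (bookkeeping)] -/
theorem psiU_zero : PsiU hd (0 : Site d → Fin d → 𝔸) = 0 := by
  funext x ν
  by_cases h : ∃ b, sig hd b = (x, ν)
  · simp only [PsiU, dif_pos h, Pi.zero_apply]
  · simp only [PsiU, dif_neg h, Pi.zero_apply]

omit hd in
/-- **An unbounded field is large at bonds of arbitrarily large code** (finitely many bonds have small code). [cite: Balaban1985RegularSpaces, p.86 (bookkeeping)] -/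
theorem exists_large {V : Site d → Fin d → 𝔸} (hV : ¬ BddF V) (C : ℝ) (N₀ : ℕ) :
    ∃ b : Site d × Fin d, N₀ ≤ encB d b ∧ C < ‖V b.1 b.2‖ := by
  have hfin : ((encB d) ⁻¹' Set.Iio N₀).Finite := (Set.finite_Iio N₀).preimage (encB_injective.injOn)
  obtain ⟨T₀, hT₀⟩ := (hfin.image fun b => ‖V b.1 b.2‖).bddAbove
  simp only [BddF, not_exists, not_forall, not_le] at hV
  obtain ⟨x, μ, hx⟩ := hV (max C T₀)
  refine ⟨(x, μ), ?_, lt_of_le_of_lt (le_max_left _ _) hx⟩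
  by_contra hlt
  have hmem : (x, μ) ∈ (encB d) ⁻¹' Set.Iio N₀ := by simpa using Nat.lt_of_not_le hlt
  have hle : ‖V x μ‖ ≤ T₀ := hT₀ ⟨(x, μ), hmem, rfl⟩
  linarith [le_max_right C T₀]

end Sparse

/-! ## §3 The extended letters: `G(U₀)J := (K(U₀) + a)⁻¹(PJ) + Ψ(J − PJ)` — TOTAL additivity -/

section Ops

variable [Nontrivial 𝔸]

open Classical in
/-- **THE EXTENDED WITNESS LETTERS ON `ℤᵈ`**: `G(U₀) := ext∘(K(U₀) + a)⁻¹∘restr∘P + Ψ∘(1 − P)` for unitary `U₀` (else `0`), `Δ′ := 0`, `DRD* := 0`,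
`Q*aQ := a·1` — the trivial massive regime extended additively to the unbounded sources, NOT [4]'s operators. [cite: Balaban1985BackgroundPropagators, (3.10) p.392, (3.16) p.393, (3.20)–(3.27) pp.394–395] -/
def opsUx (hd : 1 ≤ d) (η : ℝ) (hη : 0 < η) : OpsZd d 𝔸 where
  Gop := fun U₀ J => if hU₀ : ∀ x κ, U₀ x κ ∈ unitaryUnits 𝔸 then
      extdU (fpU hd hη hU₀ (restrU (projB J))) + PsiU hd (J - projB J) else 0
  Dp := fun _ _ _ _ => 0
  DRDs := fun _ _ _ _ => 0
  QQ := fun _ A x μ => (massA d η : ℂ) • A x μ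

/-- `G(U₀)J = ext((K + a)⁻¹ restr(PJ)) + Ψ(J − PJ)` at a unitary background. [cite: Balaban1985BackgroundPropagators, (3.27) p.395] -/
theorem opsUx_Gop (hd : 1 ≤ d) {η : ℝ} (hη : 0 < η) {U₀ : Site d → Fin d → 𝔸ˣ} (hU₀ : ∀ x κ, U₀ x κ ∈ unitaryUnits 𝔸)
    (J : Site d → Fin d → 𝔸) :
    (opsUx hd η hη).Gop U₀ J = extdU (fpU hd hη hU₀ (restrU (projB J))) + PsiU hd (J - projB J) := by
  simp only [opsUx, dif_pos hU₀]

/-- **On a BOUNDED source the extended letter IS the companion's letter** `B9SupplySockB9P3ZdUnivWitness.opsU`. [cite: Balaban1985BackgroundPropagators, (3.27) p.395] -/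
theorem opsUx_Gop_of_bddF (hd : 1 ≤ d) {η : ℝ} (hη : 0 < η) {U₀ : Site d → Fin d → 𝔸ˣ} (hU₀ : ∀ x κ, U₀ x κ ∈ unitaryUnits 𝔸)
    {J : Site d → Fin d → 𝔸} (h : BddF J) : (opsUx hd η hη).Gop U₀ J = (opsU hd η hη).Gop U₀ J := by
  rw [opsUx_Gop hd hη hU₀, opsU_Gop hd hη hU₀, projB_of_bddF h, sub_self, psiU_zero, add_zero]

/-- The extended letter at a non-unitary background is `0`. [cite: Balaban1985BackgroundPropagators, (3.27) p.395] -/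
theorem opsUx_Gop_of_not_unitary (hd : 1 ≤ d) {η : ℝ} (hη : 0 < η) {U₀ : Site d → Fin d → 𝔸ˣ} (hU₀ : ¬ ∀ x κ, U₀ x κ ∈ unitaryUnits 𝔸)
    (J : Site d → Fin d → 𝔸) : (opsUx hd η hη).Gop U₀ J = 0 := by
  simp only [opsUx, dif_neg hU₀]

/-- ★ **`G(U₀)` IS ADDITIVE ON ALL SOURCES** (`P`, `(K + a)⁻¹`, `ext`, `restr` on bounded fields and `Ψ` are additive). [cite: Balaban1985BackgroundPropagators, (3.27) p.395] -/
theorem opsUx_Gop_add (hd : 1 ≤ d) {η : ℝ} (hη : 0 < η) (U₀ : Site d → Fin d → 𝔸ˣ) (J₁ J₂ : Site d → Fin d → 𝔸) :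
    (opsUx hd η hη).Gop U₀ (J₁ + J₂) = (opsUx hd η hη).Gop U₀ J₁ + (opsUx hd η hη).Gop U₀ J₂ := by
  by_cases hU₀ : ∀ x κ, U₀ x κ ∈ unitaryUnits 𝔸
  · rw [opsUx_Gop hd hη hU₀, opsUx_Gop hd hη hU₀, opsUx_Gop hd hη hU₀, map_add, restrU_add (bddF_projB J₁) (bddF_projB J₂),
      fpU_add hd hη hU₀, extdU_add]
    have hsub : J₁ + J₂ - (projB J₁ + projB J₂) = (J₁ - projB J₁) + (J₂ - projB J₂) := by abel
    rw [hsub, psiU_add]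
    abel
  · rw [opsUx_Gop_of_not_unitary hd hη hU₀, opsUx_Gop_of_not_unitary hd hη hU₀, opsUx_Gop_of_not_unitary hd hη hU₀, add_zero]

/-- The bounded part `g = ext((K + a)⁻¹ restr(PJ))` obeys `‖g(b)‖ ≤ 2a⁻¹‖restr(PJ)‖`. [cite: Balaban1985BackgroundPropagators, (3.47) p.398] -/
theorem norm_gpart_le (hd : 1 ≤ d) {η : ℝ} (hη : 0 < η) {U₀ : Site d → Fin d → 𝔸ˣ} (hU₀ : ∀ x κ, U₀ x κ ∈ unitaryUnits 𝔸)
    (J : Site d → Fin d → 𝔸) (x : Site d) (μ : Fin d) :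
    ‖extdU (fpU hd hη hU₀ (restrU (projB J))) x μ‖ ≤ 2 * (massA d η)⁻¹ * ‖restrU (projB J)‖ :=
  (norm_extdU_le _ x μ).trans (norm_fpU_le hd hη hU₀ _)

end Ops

/-! ## §4 An UNBOUNDED source has junk readings: the three (3.47)@−3 families and the Hölder family of `G(U₀)J` are unbounded -/

section Junk

variable [Nontrivial 𝔸]

/-- A family with members beyond every bound is not `Bdd`. [cite: Balaban1985RegularSpaces, p.86 (junk convention of the weighted sup)] -/
theorem not_bdd_of_large {ι : Type*} {E : Type*} [SeminormedAddCommGroup E] {L k : ℕ} {η α : ℝ} {mem : ℕ → ι → Prop} {F : ι → E}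
    (h : ∀ C : ℝ, ∃ j, j ≤ k ∧ ∃ i, mem j i ∧ C < weight L η α j * ‖F i‖) : ¬ Bdd L k η α mem F := by
  rintro ⟨C, hC⟩
  obtain ⟨j, hj, i, hi, hlt⟩ := h C
  exact absurd (hC j hj i hi) (not_le.mpr hlt)

omit [Nontrivial 𝔸] in
/-- `R(X)0 = 0`. [folklore] -/
private theorem conjR_zero' (X : 𝔸ˣ) : conjR X (0 : 𝔸) = 0 := by
  simp [B7Eq78Linearization.conjR_apply]

omit [Nontrivial 𝔸] in
/-- **THE COVARIANT LAPLACIAN OF A SPIKE SEEN FROM A NEIGHBOUR**: if `f` vanishes at `x`, at every `x − e_μ`, and at every `x + e_μ` with `μ ≠ κ`, then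
`(Δ_{U₀}f)(x) = −η⁻²R(U₀(x,κ))f(x + e_κ)`. [cite: Balaban1985BackgroundPropagators, (3.23) p.394; Balaban1985RegularSpaces, (1.1) p.76] -/
theorem covLap_spike (η : ℝ) (U₀ : Site d → Fin d → 𝔸ˣ) {f : Site d → 𝔸} {x : Site d} {κ : Fin d} (h0 : f x = 0)
    (hm : ∀ μ : Fin d, f (x - e μ) = 0) (hp : ∀ μ : Fin d, μ ≠ κ → f (x + e μ) = 0) :
    covLap η U₀ f x = -(η⁻¹ • η⁻¹ • conjR (U₀ x κ) (f (x + e κ))) := by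
  unfold covLap covDivB
  have hterm : ∀ μ : Fin d, covDeriv η U₀ μ (fun z => covDerivFwd η U₀ μ f z) x =
      -(η⁻¹ • η⁻¹ • conjR (U₀ x μ) (f (x + e μ))) := by
    intro μ
    have hback : covDerivFwd η U₀ μ f (x - e μ) = 0 := by
      rw [covDerivFwd, sub_add_cancel, h0, hm μ, conjR_zero', sub_zero, smul_zero]
    have hfwd : covDerivFwd η U₀ μ f x = η⁻¹ • conjR (U₀ x μ) (f (x + e μ)) := by
      rw [covDerivFwd, h0, sub_zero]
    simp only [covDeriv, hback, conjR_zero', hfwd, zero_sub, smul_neg]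
  rw [Finset.sum_congr rfl fun μ _ => hterm μ]
  rw [Finset.sum_eq_single κ (fun μ _ hμ => by rw [hp μ hμ, conjR_zero', smul_zero, smul_zero, neg_zero])
    (fun h => absurd (Finset.mem_univ κ) h)]

variable {L : ℕ} (i : ZdIdx d L) (hd : 1 ≤ d)

/-- The direction `e₁` (`d ≥ 2`). [cite: Balaban1985RegularSpaces, p.76 («e_μ»)] -/
def dir1 (hd2 : 2 ≤ d) : Fin d := ⟨1, hd2⟩

/-- `e₁ ≠ e₀`. [cite: Balaban1985RegularSpaces, p.76] -/
theorem dir1_ne_dir0 (hd2 : 2 ≤ d) : dir1 hd2 ≠ dir0 hd := by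
  intro h
  have := congrArg Fin.val h
  simp [dir1, dir0] at this

/-- `s_n − e₁` has `e₁`-coordinate `−1`; `s_n − e₁ − e_μ` a non-zero one; `s_n − e₁ + e_μ` (`μ ≠ e₁`) again `−1` — all off the sparse range.
[cite: Balaban1985RegularSpaces, p.86 (bookkeeping)] -/
theorem coord1_facts (hd2 : 2 ≤ d) (n : ℕ) :
    (sparseSite hd n - e (dir1 hd2)) (dir1 hd2) = -1 ∧
    (∀ μ : Fin d, (sparseSite hd n - e (dir1 hd2) - e μ) (dir1 hd2) ≠ 0) ∧
    (∀ μ : Fin d, μ ≠ dir1 hd2 → (sparseSite hd n - e (dir1 hd2) + e μ) (dir1 hd2) = -1) := by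
  have hs : sparseSite hd n (dir1 hd2) = 0 := sparseSite_ne _ n (dir1_ne_dir0 hd hd2)
  refine ⟨?_, fun μ => ?_, fun μ hμ => ?_⟩
  · simp [hs, e_apply]
  · simp only [Pi.sub_apply, hs, e_apply, if_true]
    split_ifs <;> norm_num
  · have hne : dir1 hd2 ≠ μ := fun h => hμ h.symm
    simp [hs, e_apply, hne]

/-- A displacement with vanishing coordinates off `e₀` and at `e₀` is `0`. [cite: Balaban1985RegularSpaces, p.76] -/
theorem eq_zero_of_coords {v : Site d} (h : ∀ j, j ≠ dir0 hd → v j = 0) (h0 : v (dir0 hd) = 0) : v = 0 := by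
  funext j
  by_cases hj : j = dir0 hd
  · rw [hj, h0]; rfl
  · rw [h j hj]; rfl

/-- **No coincidences beyond the gap**: for a displacement `v ≠ 0` and `n > |v(e₀)|`, the site `s_n + v` is off the sparse range.
[cite: Balaban1985RegularSpaces, p.86 (bookkeeping)] -/
theorem not_range_add {v : Site d} (hv : v ≠ 0) {n : ℕ} (hn : (v (dir0 hd)).natAbs < n) {ν : Fin d} :
    ¬ ∃ b, sig hd b = (sparseSite hd n + v, ν) := by
  intro h
  obtain ⟨-, hcoord, ⟨m, hm⟩⟩ := of_mem_range_sig hd h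
  rw [Pi.add_apply, sparseSite_dir0] at hm
  have hoff : ∀ j, j ≠ dir0 hd → v j = 0 := by
    intro j hj
    have := hcoord j hj
    rwa [Pi.add_apply, sparseSite_ne hd n hj, zero_add] at this
  by_cases hmn : m = n
  · subst hmn
    exact hv (eq_zero_of_coords hd hoff (by linarith))
  · have hgap := cN_gap hmn
    have hv0 : v (dir0 hd) = cN m - cN n := by linarith
    have : (n : ℤ) < ((v (dir0 hd)).natAbs : ℤ) := by rw [Int.natCast_natAbs, hv0]; exact hgap
    omega

variable {η : ℝ}

/-- **READING 0 IS UNBOUNDED** for an unbounded source: at the sparse bond `σ b`, `(G J)(σ b) = g(σ b) + (J − PJ)(b)`. [cite: Balaban1985BackgroundPropagators, (3.47) p.398] -/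
theorem not_bdd_reading0 (hd2 : 2 ≤ d) (hη : 0 < η) {U : Site d → Fin d → 𝔸ˣ} (hU : ∀ x κ, U x κ ∈ unitaryUnits 𝔸) (hΩ : i.Ω 0 = Set.univ) (hηi : i.η = η)
    {J : Site d → Fin d → 𝔸} (hJ : ¬ BddF J) :
    ¬ Bdd L 0 i.η (-(1 : ℝ)) (fun j (b : Site d × Fin d) => SideTouches (i.Ω j) b.1 b.2)
      (fun b => (opsUx hd η hη).Gop U J b.1 b.2) := by
  subst hηi
  set G := 2 * (massA d i.η)⁻¹ * ‖restrU (projB J)‖ with hG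
  set g := extdU (fpU hd hη hU (restrU (projB J))) with hg_def
  have hgb : ∀ z ν, ‖g z ν‖ ≤ G := fun z ν => norm_gpart_le hd hη hU J z ν
  have hV := not_bddF_sub_projB hJ
  refine not_bdd_of_large fun C => ?_
  obtain ⟨b, -, hb⟩ := exists_large hV (C / i.η + G) 0
  have e1 : (-(1 : ℝ)) = -((1 : ℕ) : ℝ) := by norm_num
  refine ⟨0, le_rfl, (sparseSite hd (encB d b), dir0 hd), sideTouches_univ i hd2 hΩ _ _, ?_⟩
  rw [e1, B8ScaledSupNorm.weight_neg_natCast, pow_zero, one_mul, pow_one, opsUx_Gop hd hη hU, ← hg_def]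
  dsimp only
  rw [Pi.add_apply, Pi.add_apply, psiU_sig]
  have hlow : ‖(J - projB J) b.1 b.2‖ - G ≤ ‖g (sparseSite hd (encB d b)) (dir0 hd) + (J - projB J) b.1 b.2‖ := by
    have h1 := norm_sub_norm_le ((J - projB J) b.1 b.2) (-(g (sparseSite hd (encB d b)) (dir0 hd)))
    rw [norm_neg, sub_neg_eq_add, add_comm] at h1
    linarith [hgb (sparseSite hd (encB d b)) (dir0 hd)]
  have hC : C < i.η * (‖(J - projB J) b.1 b.2‖ - G) := by
    rw [div_add' _ _ _ hη.ne', div_lt_iff₀ hη] at hb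
    linarith
  exact lt_of_lt_of_le hC (mul_le_mul_of_nonneg_left hlow hη.le)

/-- The `κ`-derivative of `(g + ΨW)_{e₀}` at a site `y` off the sparse range: `D_κ g_{e₀}(y) + η⁻¹R(U(y,κ))(ΨW)(y + e_κ, e₀)`, and the `g`-part is at most
`2η⁻¹G`. [cite: Balaban1985RegularSpaces, (1.1) p.76] -/
theorem deriv_split (hη : 0 < η) {U : Site d → Fin d → 𝔸ˣ} (hU : ∀ x κ, U x κ ∈ unitaryUnits 𝔸) (κ : Fin d)
    {g : Site d → Fin d → 𝔸} {G : ℝ} (hgb : ∀ z ν, ‖g z ν‖ ≤ G) (W : Site d → Fin d → 𝔸) {y : Site d}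
    (hy : PsiU hd W y (dir0 hd) = 0) :
    covDerivFwd η U κ (fun z => (g + PsiU hd W) z (dir0 hd)) y =
        covDerivFwd η U κ (fun z => g z (dir0 hd)) y + η⁻¹ • conjR (U y κ) (PsiU hd W (y + e κ) (dir0 hd)) ∧
      ‖covDerivFwd η U κ (fun z => g z (dir0 hd)) y‖ ≤ η⁻¹ * (G + G) := by
  have hU1 : ∀ y κ, U y κ ∈ U1 𝔸 := fun y κ => unitaryUnits_le_U1 (hU y κ)
  have hsplit : (fun z => (g + PsiU hd W) z (dir0 hd)) = (fun z => g z (dir0 hd)) + fun z => PsiU hd W z (dir0 hd) := rfl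
  refine ⟨?_, (B9SupplySockB9P3ZdLettersOmega.norm_covDerivFwd_le hη (hU1 _ _) _).trans
      (mul_le_mul_of_nonneg_left (add_le_add (hgb _ _) (hgb _ _)) (inv_nonneg.mpr hη.le))⟩
  rw [hsplit, B8LambdaSpaceKLevel.covDerivFwd_add']
  congr 1
  simp only [covDerivFwd, hy, sub_zero]

/-- **READING 1 IS UNBOUNDED** for an unbounded source: the `e₁`-derivative of `(G J)_{e₀}` at `s_n − e₁` reads the spike `η⁻¹R(U)(J − PJ)(b)`.
[cite: Balaban1985BackgroundPropagators, (3.47) p.398; Balaban1985RegularSpaces, (1.1) p.76] -/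
theorem not_bdd_reading1 (hd2 : 2 ≤ d) (hη : 0 < η) {U : Site d → Fin d → 𝔸ˣ} (hU : ∀ x κ, U x κ ∈ unitaryUnits 𝔸) (hΩ : i.Ω 0 = Set.univ) (hηi : i.η = η)
    {J : Site d → Fin d → 𝔸} (hJ : ¬ BddF J) :
    ¬ Bdd L 0 i.η (-(2 : ℝ)) (fun j (t : Fin d × Fin d × Site d) => SideTouches (i.Ω j) t.2.2 t.2.1)
      (fun t => covDerivFwd i.η U t.1 (fun z => (opsUx hd η hη).Gop U J z t.2.1) t.2.2) := by
  subst hηi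
  have hU1 : ∀ y κ, U y κ ∈ U1 𝔸 := fun y κ => unitaryUnits_le_U1 (hU y κ)
  set G := 2 * (massA d i.η)⁻¹ * ‖restrU (projB J)‖ with hG
  set g := extdU (fpU hd hη hU (restrU (projB J))) with hg_def
  have hgb : ∀ z ν, ‖g z ν‖ ≤ G := fun z ν => norm_gpart_le hd hη hU J z ν
  have hV := not_bddF_sub_projB hJ
  refine not_bdd_of_large fun C => ?_
  obtain ⟨b, -, hb⟩ := exists_large hV (C / i.η + (G + G)) 0
  have e2 : (-(2 : ℝ)) = -((2 : ℕ) : ℝ) := by norm_num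
  refine ⟨0, le_rfl, (dir1 hd2, dir0 hd, sparseSite hd (encB d b) - e (dir1 hd2)), sideTouches_univ i hd2 hΩ _ _, ?_⟩
  rw [e2, B8ScaledSupNorm.weight_neg_natCast, pow_zero, one_mul, opsUx_Gop hd hη hU, ← hg_def]
  dsimp only
  have hy0 : PsiU hd (J - projB J) (sparseSite hd (encB d b) - e (dir1 hd2)) (dir0 hd) = 0 :=
    psiU_eq_zero_of_coord hd _ (dir1_ne_dir0 hd hd2) (by rw [(coord1_facts hd hd2 (encB d b)).1]; norm_num)
  obtain ⟨hsplit, hDg⟩ := deriv_split hd hη hU (dir1 hd2) hgb (J - projB J) hy0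
  rw [hsplit, sub_add_cancel, psiU_sig]
  have hnsp : ‖i.η⁻¹ • conjR (U (sparseSite hd (encB d b) - e (dir1 hd2)) (dir1 hd2)) ((J - projB J) b.1 b.2)‖ =
      i.η⁻¹ * ‖(J - projB J) b.1 b.2‖ := by
    rw [norm_smul, norm_inv, Real.norm_of_nonneg hη.le, B8Ineq132.norm_conjR (hU1 _ _)]
  have hlow : i.η⁻¹ * ‖(J - projB J) b.1 b.2‖ - i.η⁻¹ * (G + G) ≤
      ‖covDerivFwd i.η U (dir1 hd2) (fun z => g z (dir0 hd)) (sparseSite hd (encB d b) - e (dir1 hd2)) +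
        i.η⁻¹ • conjR (U (sparseSite hd (encB d b) - e (dir1 hd2)) (dir1 hd2)) ((J - projB J) b.1 b.2)‖ := by
    have h1 := norm_sub_norm_le (i.η⁻¹ • conjR (U (sparseSite hd (encB d b) - e (dir1 hd2)) (dir1 hd2)) ((J - projB J) b.1 b.2))
      (-(covDerivFwd i.η U (dir1 hd2) (fun z => g z (dir0 hd)) (sparseSite hd (encB d b) - e (dir1 hd2))))
    rw [norm_neg, sub_neg_eq_add, add_comm, hnsp] at h1
    linarith
  have hC : C < i.η ^ 2 * (i.η⁻¹ * ‖(J - projB J) b.1 b.2‖ - i.η⁻¹ * (G + G)) := by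
    rw [div_add' _ _ _ hη.ne', div_lt_iff₀ hη] at hb
    have : i.η ^ 2 * (i.η⁻¹ * ‖(J - projB J) b.1 b.2‖ - i.η⁻¹ * (G + G)) = i.η * (‖(J - projB J) b.1 b.2‖ - (G + G)) := by
      field_simp
    rw [this]; linarith
  exact lt_of_lt_of_le hC (mul_le_mul_of_nonneg_left hlow (by positivity))

/-- **READING 3 IS UNBOUNDED** for an unbounded source: the covariant Laplacian of `(G J)_{e₀}` at `s_n − e₁` reads the spike `−η⁻²R(U)(J − PJ)(b)`
(`covLap_spike`). [cite: Balaban1985BackgroundPropagators, (3.47) p.398, (3.23) p.394] -/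
theorem not_bdd_reading3 (hd2 : 2 ≤ d) (hη : 0 < η) {U : Site d → Fin d → 𝔸ˣ} (hU : ∀ x κ, U x κ ∈ unitaryUnits 𝔸) (hΩ : i.Ω 0 = Set.univ) (hηi : i.η = η)
    {J : Site d → Fin d → 𝔸} (hJ : ¬ BddF J) :
    ¬ Bdd L 0 i.η (-(3 : ℝ)) (fun j (b : Site d × Fin d) => BondTouches (i.Ω j) b.1 b.2)
      (fun b => covLap i.η U (fun z => (opsUx hd η hη).Gop U J z b.2) b.1) := by
  subst hηi
  have hdpos : (0 : ℝ) < d := by exact_mod_cast hd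
  have hU1 : ∀ y κ, U y κ ∈ U1 𝔸 := fun y κ => unitaryUnits_le_U1 (hU y κ)
  set G := 2 * (massA d i.η)⁻¹ * ‖restrU (projB J)‖ with hG
  set g := extdU (fpU hd hη hU (restrU (projB J))) with hg_def
  have hgb : ∀ z ν, ‖g z ν‖ ≤ G := fun z ν => norm_gpart_le hd hη hU J z ν
  have hV := not_bddF_sub_projB hJ
  refine not_bdd_of_large fun C => ?_
  obtain ⟨b, -, hb⟩ := exists_large hV (C / i.η + 4 * d * G) 0
  set s := sparseSite hd (encB d b) with hs_def
  have e3 : (-(3 : ℝ)) = -((3 : ℕ) : ℝ) := by norm_num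
  refine ⟨0, le_rfl, (s - e (dir1 hd2), dir0 hd), Or.inl (by rw [hΩ]; trivial), ?_⟩
  rw [e3, B8ScaledSupNorm.weight_neg_natCast, pow_zero, one_mul, opsUx_Gop hd hη hU, ← hg_def]
  dsimp only
  have hsplit : (fun z => (g + PsiU hd (J - projB J)) z (dir0 hd)) = (fun z => g z (dir0 hd)) + fun z => PsiU hd (J - projB J) z (dir0 hd) := rfl
  rw [hsplit, B9SupplySockB9P3ZdLettersOmega.covLap_add]
  obtain ⟨hc0, hcm, hcp⟩ := coord1_facts hd hd2 (encB d b)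
  have hf0 : PsiU hd (J - projB J) (s - e (dir1 hd2)) (dir0 hd) = 0 :=
    psiU_eq_zero_of_coord hd _ (dir1_ne_dir0 hd hd2) (by rw [hs_def, hc0]; norm_num)
  have hfm : ∀ μ : Fin d, PsiU hd (J - projB J) (s - e (dir1 hd2) - e μ) (dir0 hd) = 0 := fun μ =>
    psiU_eq_zero_of_coord hd _ (dir1_ne_dir0 hd hd2) (by rw [hs_def]; exact hcm μ)
  have hfp : ∀ μ : Fin d, μ ≠ dir1 hd2 → PsiU hd (J - projB J) (s - e (dir1 hd2) + e μ) (dir0 hd) = 0 := fun μ hμ =>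
    psiU_eq_zero_of_coord hd _ (dir1_ne_dir0 hd hd2) (by rw [hs_def, hcp μ hμ]; norm_num)
  have hspike := covLap_spike i.η U (f := fun z => PsiU hd (J - projB J) z (dir0 hd)) (κ := dir1 hd2) hf0 hfm hfp
  have hnsp : ‖covLap i.η U (fun z => PsiU hd (J - projB J) z (dir0 hd)) (s - e (dir1 hd2))‖ = i.η⁻¹ * (i.η⁻¹ * ‖(J - projB J) b.1 b.2‖) := by
    rw [hspike, norm_neg, norm_smul, norm_smul, norm_inv, Real.norm_of_nonneg hη.le, sub_add_cancel, hs_def, psiU_sig,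
      B8Ineq132.norm_conjR (hU1 _ _)]
  have hLg : ‖covLap i.η U (fun z => g z (dir0 hd)) (s - e (dir1 hd2))‖ ≤ 4 * d * (i.η⁻¹ * (i.η⁻¹ * G)) :=
    B9SupplySockB9P3ZdLettersOmega.norm_covLap_le hη hU1 (fun y => hgb y (dir0 hd)) _
  have hlow : i.η⁻¹ * (i.η⁻¹ * ‖(J - projB J) b.1 b.2‖) - 4 * d * (i.η⁻¹ * (i.η⁻¹ * G)) ≤
      ‖covLap i.η U (fun z => g z (dir0 hd)) (s - e (dir1 hd2)) + covLap i.η U (fun z => PsiU hd (J - projB J) z (dir0 hd)) (s - e (dir1 hd2))‖ := by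
    have h1 := norm_sub_norm_le (covLap i.η U (fun z => PsiU hd (J - projB J) z (dir0 hd)) (s - e (dir1 hd2)))
      (-(covLap i.η U (fun z => g z (dir0 hd)) (s - e (dir1 hd2))))
    rw [norm_neg, sub_neg_eq_add, add_comm, hnsp] at h1
    linarith
  have hC : C < i.η ^ 3 * (i.η⁻¹ * (i.η⁻¹ * ‖(J - projB J) b.1 b.2‖) - 4 * d * (i.η⁻¹ * (i.η⁻¹ * G))) := by
    rw [div_add' _ _ _ hη.ne', div_lt_iff₀ hη] at hb
    have : i.η ^ 3 * (i.η⁻¹ * (i.η⁻¹ * ‖(J - projB J) b.1 b.2‖) - 4 * d * (i.η⁻¹ * (i.η⁻¹ * G))) =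
        i.η * (‖(J - projB J) b.1 b.2‖ - 4 * d * G) := by
      field_simp
    rw [this]; linarith
  exact lt_of_lt_of_le hC (mul_le_mul_of_nonneg_left hlow (by positivity))

/-- The admissible pairs are translation classes: membership depends on the displacement only. [cite: Balaban1985BackgroundPropagators, (3.40) p.397] -/
theorem admPair_translate {len : Site d → ℝ} {p : Site d × Site d} (hp : p ∈ AdmPair η len) (y : Site d) :
    (y, y + (p.2 - p.1)) ∈ AdmPair η len := by
  rw [B9Eq340HolderZd.mem_admPair] at hp ⊢
  simpa [add_sub_cancel_left] using hp

omit [Nontrivial 𝔸] in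
/-- **THE SPIKE PAIR**: for an admissible displacement `v ≠ 0` there are a direction `κ` and a rank `N₀` such that for every `n ≥ N₀` the relocated field
vanishes at `s_n − e_κ`, at `s_n − e_κ + v` and at `s_n + v` (`κ = e₁` and the sparse gaps when `v ≠ e₁`; `κ = e₀` when `v = e₁`).
[cite: Balaban1985RegularSpaces, p.86 (bookkeeping of the junk convention)] -/
theorem exists_spike_dir (hd2 : 2 ≤ d) {v : Site d} (hv : v ≠ 0) :
    ∃ (κ : Fin d) (N₀ : ℕ), ∀ n, N₀ ≤ n → ∀ W : Site d → Fin d → 𝔸,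
      PsiU hd W (sparseSite hd n - e κ) (dir0 hd) = 0 ∧ PsiU hd W (sparseSite hd n - e κ + v) (dir0 hd) = 0 ∧
        PsiU hd W (sparseSite hd n + v) (dir0 hd) = 0 := by
  by_cases hv1 : v = e (dir1 hd2)
  · subst hv1
    refine ⟨dir0 hd, 0, fun n _ W => ⟨?_, ?_, ?_⟩⟩
    · refine psiU_eq_zero_of_dir0 hd W fun m => ?_
      rw [Pi.sub_apply, sparseSite_dir0, e_apply, if_pos rfl]
      exact cN_sub_one_ne n m
    · refine psiU_eq_zero_of_coord hd W (dir1_ne_dir0 hd hd2) ?_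
      simp [sparseSite_ne hd n (dir1_ne_dir0 hd hd2), e_apply, dir1_ne_dir0 hd hd2]
    · refine psiU_eq_zero_of_coord hd W (dir1_ne_dir0 hd hd2) ?_
      simp [sparseSite_ne hd n (dir1_ne_dir0 hd hd2), e_apply]
  · refine ⟨dir1 hd2, (v (dir0 hd)).natAbs + 1, fun n hn W => ⟨?_, ?_, ?_⟩⟩
    · exact psiU_eq_zero_of_coord hd W (dir1_ne_dir0 hd hd2) (by rw [(coord1_facts hd hd2 n).1]; norm_num)
    · have hv' : v - e (dir1 hd2) ≠ 0 := sub_ne_zero.2 hv1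
      have hn' : ((v - e (dir1 hd2)) (dir0 hd)).natAbs < n := by
        have : (v - e (dir1 hd2)) (dir0 hd) = v (dir0 hd) := by
          rw [Pi.sub_apply, e_apply, if_neg (dir1_ne_dir0 hd hd2).symm, sub_zero]
        rw [this]; omega
      have heq : sparseSite hd n - e (dir1 hd2) + v = sparseSite hd n + (v - e (dir1 hd2)) := by abel
      rw [heq]
      exact psiU_of_not hd W (not_range_add hd hv' hn')
    · exact psiU_of_not hd W (not_range_add hd hv (by omega))

/-- **THE HÖLDER FAMILY OF AN UNBOUNDED SOURCE HAS JUNK SUPREMUM `0`** (any `β`): either some admissible displacement `v ≠ 0` exists — then the quotient at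
the pair `(s_n − e_κ, s_n − e_κ + v)` of `exists_spike_dir` exceeds every bound — or every admissible pair is diagonal and every quotient vanishes
(`trans_self`). [cite: Balaban1985BackgroundPropagators, (3.40) p.397, (3.43) p.398] -/
theorem holder_msup_eq_zero_of_not_bddF (hd2 : 2 ≤ d) (hη : 0 < η) {U : Site d → Fin d → 𝔸ˣ} (hU : ∀ x κ, U x κ ∈ unitaryUnits 𝔸) (hΩ : i.Ω 0 = Set.univ)
    (hηi : i.η = η) (β : ℝ) (len : Site d → ℝ) {J : Site d → Fin d → 𝔸} (hJ : ¬ BddF J) :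
    msup L 0 i.η (-(2 + β)) (fun j (q : Fin d × Fin d × (Site d × Site d)) => q.2.2 ∈ AdmPair i.η len ∧ q.2.2.1 ∈ i.Ω j)
        (fun q => hquot i.η β len U (covDerivFwd i.η U q.1 (fun z => (opsUx hd η hη).Gop U J z q.2.1)) q.2.2) = 0 := by
  subst hηi
  have hU1 : ∀ y κ, U y κ ∈ U1 𝔸 := fun y κ => unitaryUnits_le_U1 (hU y κ)
  by_cases hne : ∃ p ∈ AdmPair i.η len, p.2 - p.1 ≠ 0
  · -- an admissible displacement v ≠ 0: the family is unbounded
    obtain ⟨p, hp, hv⟩ := hne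
    obtain ⟨κ, N₀, hκ⟩ := exists_spike_dir (𝔸 := 𝔸) hd hd2 hv
    set v := p.2 - p.1 with hv_def
    have hlen : 0 < len v := hp.1
    have hcv : 0 < (i.η * len v) ^ β := Real.rpow_pos_of_pos (mul_pos hη hlen) β
    have hw : 0 < i.η ^ (2 + β) := Real.rpow_pos_of_pos hη _
    refine B9SupplySockB9P3ZdSrc.msup_eq_zero_of_not_bdd (not_bdd_of_large fun C => ?_)
    set G := 2 * (massA d i.η)⁻¹ * ‖restrU (projB J)‖ with hG
    set g := extdU (fpU hd hη hU (restrU (projB J))) with hg_def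
    have hgb : ∀ z ν, ‖g z ν‖ ≤ G := fun z ν => norm_gpart_le hd hη hU J z ν
    have hV := not_bddF_sub_projB hJ
    obtain ⟨b, hbN, hb⟩ := exists_large hV (i.η * (C * (i.η * len v) ^ β / i.η ^ (2 + β)) + 4 * G) N₀
    set s := sparseSite hd (encB d b) with hs_def
    set y := s - e κ with hy_def
    obtain ⟨h1, h2, h3⟩ := hκ (encB d b) hbN (J - projB J)
    rw [← hs_def] at h1 h2 h3
    rw [← hy_def] at h1 h2
    have hwt : weight L i.η (-(2 + β)) 0 = i.η ^ (2 + β) := by simp only [weight, pow_zero, one_mul, neg_neg]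
    refine ⟨0, le_rfl, (κ, dir0 hd, (y, y + v)), ⟨admPair_translate hp y, by rw [hΩ]; trivial⟩, ?_⟩
    rw [hwt, opsUx_Gop hd hη hU, ← hg_def]
    dsimp only
    -- the derivative at y (spike) and at y + v (no spike)
    obtain ⟨hFy, hDgy⟩ := deriv_split hd hη hU κ hgb (J - projB J) h1
    obtain ⟨hFyv, hDgyv⟩ := deriv_split hd hη hU κ hgb (J - projB J) h2
    have hys : y + e κ = s := by rw [hy_def, sub_add_cancel]
    have hyvs : y + v + e κ = s + v := by rw [hy_def]; abel
    rw [hys, hs_def, psiU_sig] at hFy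
    rw [hyvs, h3, conjR_zero', smul_zero, add_zero] at hFyv
    obtain ⟨F, hF_def⟩ : ∃ F : Site d → 𝔸, F = covDerivFwd i.η U κ (fun z => (g + PsiU hd (J - projB J)) z (dir0 hd)) := ⟨_, rfl⟩
    rw [← hF_def] at hFy hFyv ⊢
    -- lower bound on the numerator: ‖F y‖ − ‖F(y + v)‖
    have hspikeN : ‖i.η⁻¹ • conjR (U y κ) ((J - projB J) b.1 b.2)‖ = i.η⁻¹ * ‖(J - projB J) b.1 b.2‖ := by
      rw [norm_smul, norm_inv, Real.norm_of_nonneg hη.le, B8Ineq132.norm_conjR (hU1 _ _)]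
    have hFy_low : i.η⁻¹ * ‖(J - projB J) b.1 b.2‖ - i.η⁻¹ * (G + G) ≤ ‖F y‖ := by
      rw [hFy]
      have hh := norm_sub_norm_le (i.η⁻¹ • conjR (U y κ) ((J - projB J) b.1 b.2)) (-(covDerivFwd i.η U κ (fun z => g z (dir0 hd)) y))
      rw [norm_neg, sub_neg_eq_add, add_comm, hspikeN] at hh
      linarith
    have hFyv_up : ‖F (y + v)‖ ≤ i.η⁻¹ * (G + G) := by rw [hFyv]; exact hDgyv
    have hnum : i.η⁻¹ * ‖(J - projB J) b.1 b.2‖ - i.η⁻¹ * (4 * G) ≤ ‖trans U y (y + v) (F (y + v)) - F y‖ := by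
      have hh := norm_sub_norm_le (F y) (trans U y (y + v) (F (y + v)))
      rw [B9Eq340HolderZd.norm_trans hU1, ← norm_neg (F y - _), neg_sub] at hh
      linarith
    -- the quotient at the pair
    have hq : hquot i.η β len U F (y, y + v) = ‖trans U y (y + v) (F (y + v)) - F y‖ / (i.η * len v) ^ β := by
      rw [B9Eq340HolderZd.hquot_def]; simp only [add_sub_cancel_left]
    have hnn : 0 ≤ hquot i.η β len U F (y, y + v) := by rw [hq]; positivity
    rw [Real.norm_of_nonneg hnn, hq]
    -- arithmetic: the threshold on ‖(J − PJ)(b)‖ makes the weighted quotient exceed C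
    have hA : C * (i.η * len v) ^ β / i.η ^ (2 + β) < i.η⁻¹ * ‖(J - projB J) b.1 b.2‖ - i.η⁻¹ * (4 * G) := by
      have hb' := hb
      have : i.η⁻¹ * ‖(J - projB J) b.1 b.2‖ - i.η⁻¹ * (4 * G) = i.η⁻¹ * (‖(J - projB J) b.1 b.2‖ - 4 * G) := by ring
      rw [this, lt_inv_mul_iff₀ hη]
      linarith
    calc C = i.η ^ (2 + β) * ((C * (i.η * len v) ^ β / i.η ^ (2 + β)) / (i.η * len v) ^ β) := by
          field_simp
      _ < i.η ^ (2 + β) * (‖trans U y (y + v) (F (y + v)) - F y‖ / (i.η * len v) ^ β) := by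
          apply mul_lt_mul_of_pos_left _ hw
          exact div_lt_div_of_pos_right (lt_of_lt_of_le hA hnum) hcv
  · -- every admissible pair is diagonal: every quotient vanishes
    have hdiag : ∀ p ∈ AdmPair i.η len, p.2 = p.1 := by
      intro p hp
      by_contra hne'
      exact hne ⟨p, hp, sub_ne_zero.2 hne'⟩
    have hzero : ∀ q : Fin d × Fin d × (Site d × Site d), q.2.2 ∈ AdmPair i.η len →
        hquot i.η β len U (covDerivFwd i.η U q.1 (fun z => (opsUx hd i.η hη).Gop U J z q.2.1)) q.2.2 = 0 := by
      intro q hq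
      have heq : q.2.2 = (q.2.2.1, q.2.2.1) := Prod.ext rfl (hdiag q.2.2 hq)
      rw [B9Eq340HolderZd.hquot_def, heq]
      simp
    refine le_antisymm (B8ScaledSupNorm.msup_le le_rfl fun j hj q hq => ?_) (B8ScaledSupNorm.msup_nonneg L 0 hη.le _ _ _)
    rw [hzero q hq.1, norm_zero, mul_zero]

end Junk

/-! ## §5 The frame over the extended letters and its bounds -/

section Frame

variable {𝔸₀ : Type} [CStarAlgebra 𝔸₀] [Nontrivial 𝔸₀]
variable {L : ℕ} (i : ZdIdx d L) (hd : 1 ≤ d)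

/-- The (3.47)@−3 entries of the extended witness = the `DictAt` readings of the extended `G(U₀)J`. [cite: Balaban1985BackgroundPropagators, (3.47) p.398] -/
def globUx (n : Fin 4) (U : Site d → Fin d → 𝔸₀ˣ) (J : Site d → Fin d → 𝔸₀) : ℝ :=
  if n = 0 then msup L 0 i.η (-(1 : ℝ)) (fun j (b : Site d × Fin d) => SideTouches (i.Ω j) b.1 b.2)
      (fun b => (opsUx hd i.η i.hη).Gop U J b.1 b.2)
  else if n = 1 then msup L 0 i.η (-(2 : ℝ)) (fun j (t : Fin d × Fin d × Site d) => SideTouches (i.Ω j) t.2.2 t.2.1)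
      (fun t => covDerivFwd i.η U t.1 (fun z => (opsUx hd i.η i.hη).Gop U J z t.2.1) t.2.2)
  else if n = 3 then bondNorm L 0 i.η (-(3 : ℝ)) i.Ω (fun x μ => covLap i.η U (fun z => (opsUx hd i.η i.hη).Gop U J z μ) x)
  else 0

/-- The extended witness KERNEL FAMILY: local entries `0` except `h1 := η^{1−β}`, global entries `globUx` at γ = −3. [cite: Balaban1985BackgroundPropagators, (3.42)–(3.47) pp.397–398] -/
def GAUx : B9.KernelFamily (geoU (𝔸₀ := 𝔸₀) i) (bgW d 𝔸₀) where
  e := fun _ _ _ _ => 0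
  h1 := fun _ _ β _ => i.η ^ (1 - β)
  e4 := fun _ _ _ => 0
  h2 := fun _ _ _ _ => 0
  l2 := fun _ _ _ _ => 0
  glob := fun n U J γ => if γ = -3 then globUx i hd n U J else 0

/-- The entries of the extended kernel family (unfoldings, `rfl`). [cite: Balaban1985BackgroundPropagators, (3.42)–(3.47) pp.397–398] -/
theorem GAUx_readings :
    (∀ n U lam y, (GAUx (𝔸₀ := 𝔸₀) i hd).e n U lam y = 0) ∧ (∀ U lam β ζ, (GAUx (𝔸₀ := 𝔸₀) i hd).h1 U lam β ζ = i.η ^ (1 - β)) ∧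
      (∀ U lam y, (GAUx (𝔸₀ := 𝔸₀) i hd).e4 U lam y = 0) ∧ (∀ U lam β ζ, (GAUx (𝔸₀ := 𝔸₀) i hd).h2 U lam β ζ = 0) ∧
      (∀ n U lam h, (GAUx (𝔸₀ := 𝔸₀) i hd).l2 n U lam h = 0) ∧
      (∀ n U lam γ, (GAUx (𝔸₀ := 𝔸₀) i hd).glob n U lam γ = if γ = -3 then globUx i hd n U lam else 0) :=
  ⟨fun _ _ _ _ => rfl, fun _ _ _ _ => rfl, fun _ _ _ => rfl, fun _ _ _ _ => rfl, fun _ _ _ _ => rfl, fun _ _ _ _ => rfl⟩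

/-- On a bounded source the extended readings ARE the companion's readings. [cite: Balaban1985BackgroundPropagators, (3.47) p.398] -/
theorem globUx_eq_globU_of_bddF {U : Site d → Fin d → 𝔸₀ˣ} (hU : ∀ x κ, U x κ ∈ unitaryUnits 𝔸₀) {J : Site d → Fin d → 𝔸₀} (hJ : BddF J)
    (n : Fin 4) : globUx i hd n U J = B9SupplySockB9P3ZdUnivWitness.globU i hd n U J := by
  simp only [globUx, B9SupplySockB9P3ZdUnivWitness.globU, opsUx_Gop_of_bddF hd i.hη hU hJ]

/-- **(3.47) AT γ = −3 FOR THE EXTENDED `G(U₀)`, `B₀ = 1`** — bounded sources by the companion's `globU_bounds`, unbounded ones by the junk readings.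
[cite: Balaban1985BackgroundPropagators, (3.47) p.398, Thm 3.3 p.399] -/
theorem globUx_bounds (hd2 : 2 ≤ d) (hΩ : i.Ω 0 = Set.univ) {U : Site d → Fin d → 𝔸₀ˣ} (hU : ∀ x κ, U x κ ∈ unitaryUnits 𝔸₀)
    (J : Site d → Fin d → 𝔸₀) (n : Fin 4) : globUx i hd n U J ≤ bondNorm L 0 i.η (-(3 : ℝ)) i.Ω J := by
  by_cases hJ : BddF J
  · rw [globUx_eq_globU_of_bddF i hd hU hJ]; exact B9SupplySockB9P3ZdUnivWitness.globU_bounds i hd hΩ hU J n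
  · have hW0 : 0 ≤ bondNorm L 0 i.η (-(3 : ℝ)) i.Ω J := B8ScaledSupNorm.msup_nonneg L 0 i.hη.le _ _ _
    unfold globUx
    split_ifs
    · rw [B9SupplySockB9P3ZdSrc.msup_eq_zero_of_not_bdd (not_bdd_reading0 i hd hd2 i.hη hU hΩ rfl hJ)]; exact hW0
    · rw [B9SupplySockB9P3ZdSrc.msup_eq_zero_of_not_bdd (not_bdd_reading1 i hd hd2 i.hη hU hΩ rfl hJ)]; exact hW0
    · unfold bondNorm
      rw [B9SupplySockB9P3ZdSrc.msup_eq_zero_of_not_bdd (not_bdd_reading3 i hd hd2 i.hη hU hΩ rfl hJ)]; exact hW0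
    · exact hW0

/-- **THE HÖLDER LINE OF THE EXTENDED WITNESS** (`0 ≤ β`): `≤ |J|₍₋₃₎` — bounded sources by the companion's `holder_line`, unbounded ones by the junk
supremum. [cite: Balaban1985BackgroundPropagators, (3.40) p.397, (3.43) p.398; Balaban1985RegularSpaces, (1.59) p.86 (Hölder line)] -/
theorem holder_lineX (hd2 : 2 ≤ d) (hΩ : i.Ω 0 = Set.univ) {β : ℝ} (hβ : 0 ≤ β) {len : Site d → ℝ} (hlen : ∀ v : Site d, 0 < len v → 1 ≤ len v)
    {U : Site d → Fin d → 𝔸₀ˣ} (hU : ∀ x κ, U x κ ∈ unitaryUnits 𝔸₀) (J : Site d → Fin d → 𝔸₀) :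
    msup L 0 i.η (-(2 + β)) (fun j (q : Fin d × Fin d × (Site d × Site d)) => q.2.2 ∈ AdmPair i.η len ∧ q.2.2.1 ∈ i.Ω j)
        (fun q => hquot i.η β len U (covDerivFwd i.η U q.1 (fun z => (opsUx hd i.η i.hη).Gop U J z q.2.1)) q.2.2)
      ≤ bondNorm L 0 i.η (-(3 : ℝ)) i.Ω J := by
  by_cases hJ : BddF J
  · simp only [opsUx_Gop_of_bddF hd i.hη hU hJ]
    exact B9SupplySockB9P3ZdUnivWitness.holder_line i hd hΩ hβ hlen hU J
  · rw [holder_msup_eq_zero_of_not_bddF i hd hd2 i.hη hU hΩ rfl β len hJ]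
    exact B8ScaledSupNorm.msup_nonneg L 0 i.hη.le _ _ _

/-- The (3.43) block of the extended frame PINS `B₀(β) ≥ 1` for `0 ≤ β < 1`. [cite: Balaban1985BackgroundPropagators, (3.43) p.398] -/
theorem one_le_of_ineq343X {Bβ Bε : ℝ → ℝ} {Bεβ : ℝ → ℝ → ℝ} {δ₀ : ℝ} {U : Site d → Fin d → 𝔸₀ˣ}
    (h : B9.Ineq343_345 (GAUx i hd) Bβ Bε Bεβ δ₀ U) {β : ℝ} (hβ0 : 0 ≤ β) (hβ1 : β < 1) : 1 ≤ Bβ β := by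
  have hη : 0 < i.η := i.hη
  have h1 := h.1 β (fun _ _ => (0 : 𝔸₀)) () () () hβ0 hβ1 trivial trivial
  rw [(GAUx_readings i hd).2.1, geoU_len, (geoU_readings i).2.2.2.2.1, (geoU_readings i).2.2.2.1, (geoU_readings i).1, mul_zero, neg_zero,
    Real.exp_zero, mul_one, mul_one, mul_one] at h1
  have hpos : 0 < i.η ^ (1 - β) := Real.rpow_pos_of_pos hη _
  have h2 : 1 * i.η ^ (1 - β) ≤ Bβ β * i.η ^ (1 - β) := by rwa [one_mul]
  exact le_of_mul_le_mul_right h2 hpos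

end Frame

/-! ## §6 The witness for the SOURCED road: all ten letters + Theorem 3.3's two blocks at `(1, i, 0)` -/

section Main

variable {𝔸₀ : Type} [CStarAlgebra 𝔸₀] [Nontrivial 𝔸₀]
variable {L : ℕ}

/-- ★★ **A6 WITNESS FOR THE SOURCED `ℤᵈ` ROAD: THE HYPOTHESIS SET OF `sockSrc_core_at_univ'` IS INHABITED AT EVERY MEMBER WITH `Ω 0 = ℤᵈ` WHOSE
LEVEL-0 CONSTRAINT BONDS AT TRUNCATION 0 ARE ALL BONDS, TRUNCATION `m = 0`** (`d ≥ 2`, `0 ≤ β < 1`, a length with «non-zero admissible displacement ⇒ ≥ 1»;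
any nontrivial C⋆-algebra `𝔸₀ : Type`): a frame, member maps, letters and constants (`M = 1`, `K₆ = c₆ = a₃ = a₀ = B₀ = CH = 1`, `c₆₉ = c_S = c_{Sβ} = 0`,
`q = aη²`, `B₀(·) = B′₀(·) = B′₀(·,·) = 1`) with `DictAt ∧ Prop6At ∧ InvAt ∧ CurvAt ∧ LandauAt ∧ AvgAt ∧ HolderAt ∧ GopAddAt ∧ SrcAt ∧ SrcHolderAt` at
`(1, i, 0)` and BOTH blocks of Theorem 3.3 for `G(U₀)` at every unitary `U₀` — letters `opsUx` (trivial massive regime + additive extension), frame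
`geoU ∕ bgW ∕ GAUx`. [cite: Balaban1985BackgroundPropagators, Thm 3.3 p.399, (3.26)–(3.27) p.395, (3.40)–(3.47) pp.397–398, (3.16) p.393, (3.20)–(3.21) p.394; Balaban1985RegularSpaces, Thm 8 + (1.146) p.101, (1.58)–(1.59) p.86, Prop. 3 p.87, p.77] -/
theorem binders_inhabited_univ_zero_src (hd2 : 2 ≤ d) (i : ZdIdx d L) (hΩ : i.Ω 0 = Set.univ)
    (hΛb : ∀ b : Site d × Fin d, b ∈ i.Λb 0 0) {β : ℝ} (hβ0 : 0 ≤ β) (hβ1 : β < 1) {len : Site d → ℝ}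
    (hlen : ∀ v : Site d, 0 < len v → 1 ≤ len v) :
    ∃ (I : Type) (geo : I → B9.Geometry) (bg : I → B9.Backgrounds) (GA : ∀ x, B9.KernelFamily (geo x) (bg x))
      (mem : ℝ → ZdIdx d L → ℕ → I)
      (ιCfg : ∀ (M : ℝ) (i' : ZdIdx d L) (m : ℕ) (U₀ : Site d → Fin d → 𝔸₀ˣ), (∀ x κ, U₀ x κ ∈ unitaryUnits 𝔸₀) → (bg (mem M i' m)).Cfg)
      (ιLoc : ∀ (M : ℝ) (i' : ZdIdx d L) (m : ℕ), (Site d → Fin d → 𝔸₀) → (geo (mem M i' m)).Loc)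
      (ops : ℝ → ZdIdx d L → ℕ → OpsZd d 𝔸₀) (c35 c₆ K₆ a₃ c69 q CH cS cSβ B₀ δ₀ a₀ : ℝ) (Bβ Bε : ℝ → ℝ) (Bεβ : ℝ → ℝ → ℝ),
      0 < K₆ ∧ 0 ≤ c69 ∧ 0 ≤ q ∧ 0 ≤ cS ∧ 0 ≤ cSβ ∧ 0 < B₀ ∧ 0 < c₆ ∧ 0 < a₃ ∧ 0 < a₀ ∧ 0 ≤ CH ∧
      DictAt geo bg GA L mem ιCfg ιLoc ops 1 i 0 ∧ Prop6At bg L mem ιCfg c35 c₆ K₆ 1 i 0 ∧ InvAt bg L mem ιCfg ops c35 a₃ 1 i 0 ∧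
      CurvAt bg L mem ιCfg ops c35 a₃ c69 1 i 0 ∧ LandauAt bg L mem ιCfg ops c35 a₃ 1 i 0 ∧ AvgAt L ops q 1 i 0 ∧
      HolderAt geo bg GA L mem ιCfg ops β len CH 1 i 0 ∧ GopAddAt L ops 1 i 0 ∧ SrcAt bg L mem ιCfg ops c35 a₃ cS 1 i 0 ∧
      SrcHolderAt bg L mem ιCfg ops c35 a₃ β len cSβ 1 i 0 ∧
      (∀ (α₀ : ℝ) (U₀ : Site d → Fin d → 𝔸₀ˣ) (hU₀ : ∀ x κ, U₀ x κ ∈ unitaryUnits 𝔸₀), 0 < α₀ → 1 * α₀ ≤ a₀ →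
        (bg (mem 1 i 0)).Reg335 c35 α₀ (ιCfg 1 i 0 U₀ hU₀) →
        B9.Ineq342_346_347 (GA (mem 1 i 0)) B₀ δ₀ (ιCfg 1 i 0 U₀ hU₀) ∧
          B9.Ineq343_345 (GA (mem 1 i 0)) Bβ Bε Bεβ δ₀ (ιCfg 1 i 0 U₀ hU₀)) := by
  classical
  have hd : 1 ≤ d := le_trans one_le_two hd2
  have hη : 0 < i.η := i.hη
  have hdpos : (0 : ℝ) < d := by exact_mod_cast hd
  have ha : 0 < massA d i.η := by unfold massA; positivity
  have hbt : ∀ (y : Site d) (τ : Fin d), BondTouches (i.Ω 0) y τ := fun y τ => Or.inl (by rw [hΩ]; trivial)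
  -- the value of G(U₀) at the ZERO source (the source term `G(U₀)DRD*A` of the witness, `DRD* := 0`)
  have hG0 : ∀ (U₀ : Site d → Fin d → 𝔸₀ˣ), (∀ x κ, U₀ x κ ∈ unitaryUnits 𝔸₀) →
      (opsUx hd i.η hη).Gop U₀ (fun _ _ => (0 : 𝔸₀)) = fun _ _ => 0 := by
    intro U₀ hU₀
    have hb0 : BddF (fun (_ : Site d) (_ : Fin d) => (0 : 𝔸₀)) := ⟨0, fun _ _ => by simp⟩
    have hr : restrU (fun (_ : Site d) (_ : Fin d) => (0 : 𝔸₀)) = 0 := by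
      ext b; rw [restrU_apply hb0]; rfl
    rw [opsUx_Gop_of_bddF hd hη hU₀ hb0, opsU_Gop hd hη hU₀, hr, fpU_zero hd hη hU₀, extdU_zero]; rfl
  refine ⟨Unit, fun _ => geoU i, fun _ => bgW d 𝔸₀, fun _ => GAUx i hd, fun _ _ _ => (), fun _ _ _ U₀ _ => U₀, fun _ _ _ J => J,
    fun _ _ _ => opsUx hd i.η hη, 0, 1, 1, 1, 0, massA d i.η * i.η ^ 2, 1, 0, 0, 1, 0, 1, fun _ => 1, fun _ => 1, fun _ _ => 1,
    one_pos, le_rfl, by positivity, le_rfl, le_rfl, one_pos, one_pos, one_pos, one_pos, zero_le_one, ?_, ?_, ?_, ?_, ?_, ?_, ?_, ?_, ?_, ?_, ?_⟩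
  · -- the norm dictionary: by construction of the frame
    refine ⟨rfl, fun U₀ hU₀ J => ⟨?_, ?_, ?_, ?_⟩⟩
    · rw [(geoU_readings i).2.2.2.2.2.2, if_pos rfl]
    · rw [(GAUx_readings i hd).2.2.2.2.2, if_pos rfl]; simp [globUx]
    · rw [(GAUx_readings i hd).2.2.2.2.2, if_pos rfl]; simp [globUx]
    · rw [(GAUx_readings i hd).2.2.2.2.2, if_pos rfl]; simp [globUx]
  · -- Proposition 6's class: `Reg335 := ⊤`
    intro _ _ _ _ _ _; trivial
  · -- (3.27): on E(ℤᵈ) (bounded fields) the source Δ_aA is bounded and G(U₀) is the companion's left inverse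
    intro α₀ U₀ hU₀ _ _ _ A hA J hJ
    obtain ⟨c, hc⟩ := hA.2
    have e1 : (-(1 : ℝ)) = -((1 : ℕ) : ℝ) := by norm_num
    have hw1 : weight L i.η (-(1 : ℝ)) 0 = i.η := by rw [e1, B8ScaledSupNorm.weight_neg_natCast, pow_zero, one_mul, pow_one]
    have hAb : BddF A := by
      refine ⟨c / i.η, fun y τ => ?_⟩
      have h := hc 0 le_rfl (y, τ) (sideTouches_univ i hd2 hΩ y τ)
      rw [hw1] at h
      rw [le_div_iff₀ hη, mul_comm]; exact h
    have hJ' : ∀ (y : Site d) (τ : Fin d), J y τ = Jcur i.η U₀ A τ y + (massA d i.η : ℂ) • A y τ := by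
      intro y τ
      rw [hJ y τ (hbt y τ)]
      simp [deltaAOf, opsUx]
    have hJb : BddF J := by
      obtain ⟨C₁, hC₁⟩ := bddF_Jcur hη hU₀ hAb
      obtain ⟨C₂, hC₂⟩ := hAb
      refine ⟨C₁ + massA d i.η * C₂, fun y τ => ?_⟩
      rw [hJ' y τ]
      refine (norm_add_le _ _).trans (add_le_add (hC₁ y τ) ?_)
      rw [norm_smul, Complex.norm_real, Real.norm_of_nonneg ha.le]
      exact mul_le_mul_of_nonneg_left (hC₂ y τ) ha.le
    have hfix := fpU_unique hd hη hU₀ (restrU J) (phiU_restr_of_eq hd hη hU₀ hAb hJ')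
    show (opsUx hd i.η hη).Gop U₀ J = A
    rw [opsUx_Gop_of_bddF hd hη hU₀ hJb, opsU_Gop hd hη hU₀, ← hfix, extdU_restrU hAb]
  · -- (3.69): `Δ′ := 0`
    intro α₀ U₀ hU₀ hα₀ _ _ A _ j _ x μ _
    show ((L : ℝ) ^ j * i.η) ^ 3 * ‖(0 : 𝔸₀)‖ ≤ 0 * 1 * α₀ * _
    simp
  · -- the Landau letter: `DRD* := 0`
    intro _ _ _ _ _ _ _ _ _ _ _; rfl
  · -- (3.16): `Q*aQ := a·1`, `q := aη²`; every bond is a level-0 constraint bond at truncation 0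
    intro U₀ hU₀ A hA j hj x μ hb
    obtain rfl : j = 0 := Nat.le_zero.mp hj
    show ((L : ℝ) ^ 0 * i.η) ^ 3 * ‖(massA d i.η : ℂ) • A x μ‖ ≤ _
    obtain ⟨c, hc⟩ := hA.2
    have e1 : (-(1 : ℝ)) = -((1 : ℕ) : ℝ) := by norm_num
    have hw1 : weight L i.η (-(1 : ℝ)) 0 = i.η := by rw [e1, B8ScaledSupNorm.weight_neg_natCast, pow_zero, one_mul, pow_one]
    have hnormA : ∀ (y : Site d) (τ : Fin d), i.η * ‖A y τ‖ ≤ c := fun y τ => by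
      have := hc 0 le_rfl (y, τ) (sideTouches_univ i hd2 hΩ y τ); rwa [hw1] at this
    have hbd : ∀ p : {p : ℕ × (Site d × Fin d) // p.1 ≤ 0 ∧ p.2 ∈ i.Λb 0 p.1},
        1 * ‖linCovIter L U₀ (iEta i.η A) p.1.1 p.1.2.1 p.1.2.2‖ ≤ c := by
      rintro ⟨⟨j', b⟩, hj', -⟩
      obtain rfl : j' = 0 := Nat.le_zero.mp hj'
      dsimp only
      rw [one_mul, B7Prop4GeneralLevels.linCovIter_zero, iEta, norm_smul, norm_mul, Complex.norm_I, one_mul, Complex.norm_real,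
        Real.norm_of_nonneg hη.le]
      exact hnormA b.1 b.2
    have hle := B8Eq155JBound.le_wsup hbd ⟨(0, (x, μ)), le_rfl, hΛb (x, μ)⟩
    dsimp only at hle
    rw [one_mul, B7Prop4GeneralLevels.linCovIter_zero, iEta, norm_smul, norm_mul, Complex.norm_I, one_mul, Complex.norm_real,
      Real.norm_of_nonneg hη.le] at hle
    rw [pow_zero, one_mul, norm_smul, Complex.norm_real, Real.norm_of_nonneg ha.le]
    calc i.η ^ 3 * (massA d i.η * ‖A x μ‖) = (massA d i.η * i.η ^ 2) * (i.η * ‖A x μ‖) := by ring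
      _ ≤ (massA d i.η * i.η ^ 2) * _ := mul_le_mul_of_nonneg_left hle (by positivity)
  · -- the Hölder binder: (3.43)'s block pins `Bβ β ≥ 1`; `holder_lineX` gives `≤ |J|₍₋₃₎`
    intro Bβ Bε Bεβ δ₀ U₀ hU₀ h343 J
    have hB : 1 ≤ Bβ β := one_le_of_ineq343X i hd h343 hβ0 hβ1
    have hW0 : 0 ≤ bondNorm L 0 i.η (-(3 : ℝ)) i.Ω J := B8ScaledSupNorm.msup_nonneg L 0 hη.le _ _ _
    calc _ ≤ bondNorm L 0 i.η (-(3 : ℝ)) i.Ω J := holder_lineX i hd hd2 hΩ hβ0 hlen hU₀ J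
      _ = 1 * 1 * bondNorm L 0 i.η (-(3 : ℝ)) i.Ω J := by ring
      _ ≤ 1 * Bβ β * bondNorm L 0 i.η (-(3 : ℝ)) i.Ω J := by gcongr
  · -- ★ additivity of G(U₀) on ALL sources
    intro U₀ J₁ J₂
    exact opsUx_Gop_add hd hη U₀ J₁ J₂
  · -- the source term through `G(U₀)DRD*A = G(U₀)0 = 0`: every line is `0 ≤ 0·|f|`
    intro α₀ U₀ hU₀ _ _ _ A _ f _ _
    have hz := hG0 U₀ hU₀
    simp only [show (fun z κ => (opsUx hd i.η hη).DRDs U₀ A z κ) = fun _ _ => (0 : 𝔸₀) from rfl, hz]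
    refine ⟨⟨0, fun y τ => by simp⟩, ?_, ?_, ?_⟩
    · rw [zero_mul]
      exact B8ScaledSupNorm.msup_le le_rfl fun j hj b _ => by rw [norm_zero, mul_zero]
    · rw [zero_mul]
      exact B8ScaledSupNorm.msup_le le_rfl fun j hj t _ => by rw [covDerivFwd_zero_fun, norm_zero, mul_zero]
    · rw [zero_mul]
      refine B8ScaledSupNorm.msup_le le_rfl fun j hj b _ => ?_
      have hU1 : ∀ y κ, U₀ y κ ∈ U1 𝔸₀ := fun y κ => unitaryUnits_le_U1 (hU₀ y κ)
      have h0 : ‖covLap i.η U₀ (fun _ => (0 : 𝔸₀)) b.1‖ ≤ 0 := by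
        have := B9SupplySockB9P3ZdLettersOmega.norm_covLap_le hη hU1 (f := fun _ => (0 : 𝔸₀)) (s := 0) (fun _ => by simp) b.1
        simpa using this
      rw [le_antisymm h0 (norm_nonneg _), mul_zero]
  · -- the Hölder line of the source term: quotients of the zero field vanish
    intro α₀ U₀ hU₀ _ _ _ A _ f _ _
    have hz := hG0 U₀ hU₀
    simp only [show (fun z κ => (opsUx hd i.η hη).DRDs U₀ A z κ) = fun _ _ => (0 : 𝔸₀) from rfl, hz]
    have hq0 : ∀ q : Fin d × Fin d × (Site d × Site d),
        hquot i.η β len U₀ (covDerivFwd i.η U₀ q.1 fun _ => (0 : 𝔸₀)) q.2.2 = 0 := by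
      intro q
      have : (covDerivFwd i.η U₀ q.1 fun _ => (0 : 𝔸₀)) = fun _ => 0 := funext fun y => covDerivFwd_zero_fun i.η U₀ q.1 y
      rw [this, hquot_zero_fun]
    refine ⟨⟨0, fun j hj q _ => by simp only [hq0, norm_zero, mul_zero, le_refl]⟩, ?_⟩
    rw [zero_mul]
    exact B8ScaledSupNorm.msup_le le_rfl fun j hj q _ => by simp only [hq0, norm_zero, mul_zero, le_refl]
  · -- Theorem 3.3's two blocks for the extended G(U₀)
    intro α₀ U₀ hU₀ _ _ _
    have hpref4 : ∀ (n : Fin 4) (t : ℝ), 0 ≤ t → 0 ≤ B9.pref4 t n := fun n t ht => by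
      fin_cases n <;> simp [B9.pref4] <;> positivity
    obtain ⟨gsup, gl2, ghol, gdist, gcutH, gcutSup, gw⟩ := geoU_readings (𝔸₀ := 𝔸₀) i
    obtain ⟨Ge, Gh1, Ge4, Gh2, Gl2, Gglob⟩ := GAUx_readings (𝔸₀ := 𝔸₀) i hd
    refine ⟨⟨fun n lam y y' _ => ?_, fun n lam h y y' _ _ => ?_, fun n lam γ _ _ => ?_⟩, ⟨?_, ?_, ?_⟩⟩
    · rw [Ge, geoU_len, gdist, gsup, mul_zero, neg_zero, Real.exp_zero, mul_one, mul_one, one_mul]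
      exact hpref4 n i.η hη.le
    · rw [Gl2, gcutSup, mul_zero, zero_mul, zero_mul]
    · by_cases hγ : γ = -3
      · rw [Gglob, gw, if_pos hγ, if_pos hγ, one_mul]; exact globUx_bounds i hd hd2 hΩ hU₀ lam n
      · rw [Gglob, gw, if_neg hγ, if_neg hγ, mul_zero]
    · intro β' lam ζ y y' _ _ _ _
      rw [Gh1, geoU_len, gcutH, gdist, gsup, mul_zero, neg_zero, Real.exp_zero, mul_one, mul_one, mul_one, one_mul]
    · intro ε lam y y' _ _ _
      rw [Ge4, gdist, ghol, gsup, mul_zero, neg_zero, Real.exp_zero, zero_add, mul_one, mul_one]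
      exact zero_le_one
    · intro ε β' lam ζ y y' _ _ _ _ _ _
      rw [Gh2, geoU_len, gcutH, gdist, ghol, gsup, mul_zero, neg_zero, Real.exp_zero, zero_add, mul_one, mul_one, mul_one, one_mul]
      exact Real.rpow_nonneg hη.le _

end Main

end Literature.MathematicalPhysics.QuantumFieldTheory.Balaban1983to89.B9SupplySockB9P3ZdUnivWitnessSrc

end
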